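import Summits.BirchSwinnertonDyer.BirchSwinnertonDyer.Theorems.BiquadraticEisensteinDescentHeegnerTwistCouplingInSupplyIndefinitePinWitness
import HarnessLib

set_option linter.dupNamespace false -- `Summit.BirchSwinnertonDyer.BirchSwinnertonDyer.Theorems.…` (summit = sub)
set_option autoImplicit false

/-!
# Crux `HeegnerTwistCouplingInSupply` (stmt-BirchSwinnertonDyer-21381) — the number theory of card `sqrt2-isogeny-heegner-pin`
# (j = 8000, CM by ℤ[√−2]): the ternary pin `(3,−)` at `p ≡ 5 (mod 8)`, the free pin `(5,−)` at `p ≡ 7 (mod 8)`, and the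
# Heegner field `K′ = ℚ(√−5ℓ)` of target T_A with `h(K′) < p` — PROVED; the `L`-half (CELL-5) is NOT here

Route `BiquadraticEisensteinDescent` (cell `pub/bsd-wall`, row-12 line lead `bsd-line-ibd-p1` g11). Card `sqrt2-isogeny-heegner-pin`
(crux-ideate seat 2 g15, 2026-08-28T16:06Z) is corner-only (W in the j = 8000 family `B_n : y² = x³ + 4n x² + 2n² x`, p ≡ 5, 7 (mod 8)),
hence — like `three-squares-heegner-pin` — not a line for the crux as stated; this file lands its provable number theory at once:

* §1–§2 `pinThreeMinus_of_mod_eight_eq_five` — the card's FIRST LEMMA, signature verbatim: every prime `p ≡ 5 (mod 8)` has a prime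
  `ℓ < p`, `ℓ ≡ 3 (mod 8)`, `(ℓ/p) = −1`. Proof (card): Legendre–Gauss (tree `sum_three_squares_iff_mod_eight`) gives
  `p = a² + b² + c²` with squares `{1, 4, 0} (mod 8)`; `u = a`, `v = (b+c)/2`, `w = |b−c|/2` are odd and `p = u² + 2v² + 2w²`;
  `R = u² + 2v² = p − 2w² ≡ 3 (mod 8)` has a prime factor `ℓ ≡ 3 (mod 8)` (p643125 `exists_prime_dvd_mod_eight_eq_three`), `ℓ ≤ R < p`,
  `p ≡ 2w² (mod ℓ)`, `ℓ ∤ w` ⇒ `(p/ℓ) = (2/ℓ) = −1` ⇒ `(ℓ/p) = −1` (reciprocity, `p ≡ 1 (mod 4)`). Non-degeneracy is automatic (`w` odd).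
* §3 `pinFiveMinus_of_mod_eight_eq_seven` — the card's "free" pin: every prime `p ≡ 7 (mod 8)` has a prime `ℓ < p`, `ℓ ≡ 5 (mod 8)`,
  `(ℓ/p) = −1` (from p643125's certificate `p = u² + 2v² + w²`: `u² + w² = p − 2v² ≡ 5 (mod 8)`), sharpening p642610's `ℓ < 2p`.
* §4 target T_A's FIELD half (`exists_sqrtTwoPin_witnessField`): for every prime `p ≡ 5 (mod 8)`, `p ≡ ±2 (mod 5)`: the pin `ℓ` and
  `K′ = ℚ(√−5ℓ)` — imaginary quadratic, `d_{K′} = −5ℓ ≡ 1 (mod 8)` (2 splits), `(d_{K′}/p) = +1` (p splits), Heegner for every level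
  whose primes are among `{2, p}` (e.g. `N(B_p) = 2⁸p²`), `h(K′) < p` (size: `5ℓ < 5p < 6p`, p645024's lever), and the twist parameter
  `m = 5·p·ℓ` has all prime factors `≡ ±3 (mod 8)` (CELL-5 membership, stated arithmetically).

NOT here (what T_A still needs): the `L`-half `L(B_p^{(−5ℓ)}, 1) ≠ 0`, i.e. CELL-5 (`Sel₂(B_{−m}) = ℤ/2` for `m` squarefree odd with
all prime factors `≡ ±3 (mod 8)`) — it rests on DESCENT VIA TWO-ISOGENY (Silverman AEC X.4.9), not yet a named fact of the tree, plus
Burungale–Tian's rank-zero converse, Deuring–Hecke for `j = 8000`, and the conductor `N(B_p) = 2⁸p²`; and CELL-15's `2 ± √2` law.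
THEOREMS ONLY; nothing about `L`-values, the crux (all CM `W`) or any case of BSD is asserted. Supports stmt-BirchSwinnertonDyer-21381.
-/

namespace Summit.BirchSwinnertonDyer.BirchSwinnertonDyer.Theorems.BiquadraticEisensteinDescentHeegnerTwistCouplingInSupplySqrtTwoPin

open Literature.NumberTheory.Waring Literature.NumberTheory.EllipticCurves
  Literature.NumberTheory.EllipticCurves.HeathBrown1994.Families
  Summit.BirchSwinnertonDyer.BirchSwinnertonDyer.Theorems.BiquadraticEisensteinDescentHeegnerTwistCouplingInSupplyThreeSquaresPin
  Summit.BirchSwinnertonDyer.BirchSwinnertonDyer.Theorems.BiquadraticEisensteinDescentHeegnerTwistCouplingInSupplyThreeSquaresPinDual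
  Summit.BirchSwinnertonDyer.BirchSwinnertonDyer.Theorems.BiquadraticEisensteinDescentHeegnerTwistCouplingInSupplyThreeSquaresPinCornerDual
  Summit.BirchSwinnertonDyer.BirchSwinnertonDyer.Theorems.BiquadraticEisensteinDescentHeegnerTwistCouplingInSupplyIndefinitePinWitness

/-! ## §1 Tools -/

/-- From `x² + y² + z² = n` with `n ≡ 5 (mod 8)`: a representation with the first coordinate odd, the second `≡ 2 (mod 4)` and the
third `≡ 0 (mod 4)` (the squares are `{1, 4, 0} (mod 8)`; permute). [folklore] -/
theorem exists_sq_add_sq_add_sq_of_mod_eight_eq_five {x y z n : ℕ} (h : x ^ 2 + y ^ 2 + z ^ 2 = n) (hn : n % 8 = 5) :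
    ∃ a b c : ℕ, a ^ 2 + b ^ 2 + c ^ 2 = n ∧ a % 2 = 1 ∧ b % 4 = 2 ∧ c % 4 = 0 := by
  rcases sq_mod_eight_cases x with ⟨hx, hx8⟩ | ⟨hx, hx8⟩ | ⟨hx, hx8⟩ <;>
  rcases sq_mod_eight_cases y with ⟨hy, hy8⟩ | ⟨hy, hy8⟩ | ⟨hy, hy8⟩ <;>
  rcases sq_mod_eight_cases z with ⟨hz, hz8⟩ | ⟨hz, hz8⟩ | ⟨hz, hz8⟩
  all_goals first
    | exact ⟨x, y, z, h, hx, hy, hz⟩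
    | exact ⟨x, z, y, by rw [← h]; ring, hx, hz, hy⟩
    | exact ⟨y, x, z, by rw [← h]; ring, hy, hx, hz⟩
    | exact ⟨y, z, x, by rw [← h]; ring, hy, hz, hx⟩
    | exact ⟨z, x, y, by rw [← h]; ring, hz, hx, hy⟩
    | exact ⟨z, y, x, by rw [← h]; ring, hz, hy, hx⟩
    | (exfalso; omega)

/-- **Reading `(p/ℓ) = −1` off `R + 2t² = p`**: for primes `p` and `ℓ ≡ 3, 5 (mod 8)` with `ℓ ∣ R`, `R + 2t² = p`, `ℓ ∤ t`:
`p ≡ 2t² (mod ℓ)` and `(2/ℓ) = −1` give `(p/ℓ) = −1`. [folklore] -/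
theorem jacobiSym_eq_neg_one_of_add_two_mul_sq {p ℓ R t : ℕ} (hℓ : ℓ.Prime) (hℓ8 : ℓ % 8 = 3 ∨ ℓ % 8 = 5)
    (hℓR : ℓ ∣ R) (hR : R + 2 * t ^ 2 = p) (hℓt : ¬ ℓ ∣ t) : jacobiSym (p : ℤ) ℓ = -1 := by
  have hgcd : (t : ℤ).gcd ℓ = 1 := by
    rw [Int.gcd_natCast_natCast]
    exact Nat.coprime_comm.mp ((Nat.Prime.coprime_iff_not_dvd hℓ).mpr hℓt)
  have hsq : jacobiSym ((t : ℤ) ^ 2) ℓ = 1 := jacobiSym.sq_one' hgcd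
  have h2 : jacobiSym 2 ℓ = -1 := jacobiSym_two_eq_neg_one hℓ8
  have hmod : (p : ℤ) % (ℓ : ℤ) = (2 * (t : ℤ) ^ 2) % (ℓ : ℤ) := by
    rw [Int.emod_eq_emod_iff_emod_sub_eq_zero]
    have : (p : ℤ) - 2 * (t : ℤ) ^ 2 = ((R : ℕ) : ℤ) := by rw [← hR]; push_cast; ring
    rw [this]
    exact Int.emod_eq_zero_of_dvd (Int.natCast_dvd_natCast.mpr hℓR)
  rw [jacobiSym.mod_left' hmod, jacobiSym.mul_left, h2, hsq]
  norm_num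

/-! ## §2 The pin `(3,−)` at `p ≡ 5 (mod 8)` (card `sqrt2-isogeny-heegner-pin`, first lemma) -/

/-- **The ternary certificate at `p ≡ 5 (mod 8)`.** For a prime `p ≡ 5 (mod 8)` there are `u v w ℓ : ℕ`, all of `u, v, w` odd,
with `u² + 2v² + 2w² = p`, `ℓ` a prime `≡ 3 (mod 8)` dividing `u² + 2v² = p − 2w²`, `ℓ < p` and `(ℓ/p) = −1`. [folklore] -/
theorem exists_ternary_certificate_five {p : ℕ} (hp : p.Prime) (hp8 : p % 8 = 5) :
    ∃ u v w ℓ : ℕ, u ^ 2 + 2 * v ^ 2 + 2 * w ^ 2 = p ∧ u % 2 = 1 ∧ v % 2 = 1 ∧ w % 2 = 1 ∧ ℓ.Prime ∧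
      ℓ ∣ u ^ 2 + 2 * v ^ 2 ∧ ℓ % 8 = 3 ∧ ℓ < p ∧ jacobiSym (ℓ : ℤ) p = -1 := by
  have h4 : ¬ 4 ∣ p := by omega
  obtain ⟨x₀, y₀, z₀, h₀⟩ := (sum_three_squares_iff_mod_eight h4).mpr (by omega)
  obtain ⟨a, b, c, habc, ha, hb, hc⟩ := exists_sq_add_sq_add_sq_of_mod_eight_eq_five h₀ hp8
  -- `v = (b + c)/2`, `w = |b - c|/2`, both odd; `2v² + 2w² = b² + c²`
  obtain ⟨v, hv⟩ : ∃ v, b + c = 2 * v := ⟨(b + c) / 2, by omega⟩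
  obtain ⟨w, hw⟩ : ∃ w, (max b c - min b c) = 2 * w := ⟨(max b c - min b c) / 2, by omega⟩
  have hv2 : v % 2 = 1 := by omega
  have hw2 : w % 2 = 1 := by
    rcases le_total b c with hbc | hbc
    · rw [max_eq_right hbc, min_eq_left hbc] at hw
      omega
    · rw [max_eq_left hbc, min_eq_right hbc] at hw
      omega
  have hid : a ^ 2 + 2 * v ^ 2 + 2 * w ^ 2 = p := by
    rcases le_total b c with hbc | hbc
    · rw [max_eq_right hbc, min_eq_left hbc] at hw
      have hc' : c = b + 2 * w := by omega
      subst hc'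
      have hv' : v = b + w := by omega
      subst hv'
      nlinarith [habc]
    · rw [max_eq_left hbc, min_eq_right hbc] at hw
      have hb' : b = c + 2 * w := by omega
      subst hb'
      have hv' : v = c + w := by omega
      subst hv'
      nlinarith [habc]
  -- `R = a² + 2v² ≡ 3 (mod 8)` and its prime factor `ℓ ≡ 3 (mod 8)`
  have ha8 : a ^ 2 % 8 = 1 := sq_mod_eight_of_odd ha
  have hv8 : v ^ 2 % 8 = 1 := sq_mod_eight_of_odd hv2
  have hR3 : (a ^ 2 + 2 * v ^ 2) % 8 = 3 := by omega
  obtain ⟨ℓ, hℓ, hℓR, hℓ8⟩ := exists_prime_dvd_mod_eight_eq_three (m := a ^ 2 + 2 * v ^ 2) rfl hR3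
  have hRpos : 0 < a ^ 2 + 2 * v ^ 2 := by omega
  have hℓle : ℓ ≤ a ^ 2 + 2 * v ^ 2 := Nat.le_of_dvd hRpos hℓR
  have hw1 : 1 ≤ w ^ 2 := Nat.one_le_pow 2 w (by omega)
  have hℓlt : ℓ < p := by omega
  -- `ℓ ∤ w`: otherwise `ℓ ∣ p`, `ℓ = p`
  have hℓw : ¬ ℓ ∣ w := by
    intro hℓw'
    have hℓp : ℓ ∣ p := by
      have h1 : ℓ ∣ 2 * w ^ 2 := Dvd.dvd.mul_left (Dvd.dvd.pow hℓw' two_ne_zero) 2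
      rw [← hid]
      exact Dvd.dvd.add hℓR h1
    have := (Nat.prime_dvd_prime_iff_eq hℓ hp).mp hℓp
    omega
  refine ⟨a, v, w, ℓ, hid, ha, hv2, hw2, hℓ, hℓR, hℓ8, hℓlt, ?_⟩
  -- the symbol: `(p/ℓ) = −1`, reciprocity at `p ≡ 1 (mod 4)`
  have hpℓ : jacobiSym (p : ℤ) ℓ = -1 :=
    jacobiSym_eq_neg_one_of_add_two_mul_sq hℓ (Or.inl hℓ8) hℓR hid hℓw
  rw [jacobiSym.quadratic_reciprocity_one_mod_four' (Nat.odd_iff.mpr (by omega)) (by omega), hpℓ]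

/-- **`pinThreeMinus_of_mod_eight_eq_five`** (card `sqrt2-isogeny-heegner-pin`, FIRST LEMMA, signature VERBATIM from
`Cruxes/HeegnerTwistCouplingInSupply` `Sketch.lean` namespace `SqrtTwoPin`), PROVED: every prime `p ≡ 5 (mod 8)` has a prime `ℓ < p`
with `ℓ ≡ 3 (mod 8)` and `(ℓ/p) = −1`. [folklore] -/
theorem pinThreeMinus_of_mod_eight_eq_five : ∀ p : ℕ, p.Prime → p % 8 = 5 →
    ∃ ℓ : ℕ, ℓ.Prime ∧ ℓ < p ∧ ℓ % 8 = 3 ∧ jacobiSym (ℓ : ℤ) p = -1 := by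
  intro p hp hp8
  obtain ⟨-, -, -, ℓ, -, -, -, -, hℓ, -, hℓ8, hℓlt, hJ⟩ := exists_ternary_certificate_five hp hp8
  exact ⟨ℓ, hℓ, hℓlt, hℓ8, hJ⟩

/-! ## §3 The free pin `(5,−)` at `p ≡ 7 (mod 8)`, `ℓ < p` -/

/-- **`(5,−)` below `p` at `p ≡ 7 (mod 8)`** (card `sqrt2-isogeny-heegner-pin`, "new but free"): every prime `p ≡ 7 (mod 8)` has a
prime `ℓ < p`, `ℓ ≡ 5 (mod 8)`, `(ℓ/p) = −1` — from p643125's certificate `p = u² + 2v² + w²` (`u` odd, `w` even non-zero):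
`2v² + w² ≡ 6 (mod 8)` forces `v` odd and `w ≡ 2 (mod 4)`, so `u² + w² = p − 2v² ≡ 5 (mod 8)` has a prime factor `ℓ ≡ 5 (mod 8)`
(p642610 `exists_prime_dvd_mod_eight_eq_five`), `ℓ < p`, `(p/ℓ) = (2/ℓ) = −1`, `(ℓ/p) = (p/ℓ)`. Sharpens p642610's `ℓ < 2p`. [folklore] -/
theorem pinFiveMinus_of_mod_eight_eq_seven : ∀ p : ℕ, p.Prime → p % 8 = 7 →
    ∃ ℓ : ℕ, ℓ.Prime ∧ ℓ < p ∧ ℓ % 8 = 5 ∧ jacobiSym (ℓ : ℤ) p = -1 := by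
  intro p hp hp8
  obtain ⟨u, v, w, -, huvw, hu, hw, hw0, -, -, -, -, -⟩ := exists_ternary_certificate hp hp8
  have hu8 : u ^ 2 % 8 = 1 := sq_mod_eight_of_odd hu
  -- `v` odd and `w ≡ 2 (mod 4)`
  have hv2 : v % 2 = 1 := by
    rcases sq_mod_eight_cases v with ⟨hv, _⟩ | ⟨_, hv8⟩ | ⟨_, hv8⟩
    · exact hv
    all_goals
      rcases sq_mod_eight_cases w with ⟨hw1, _⟩ | ⟨_, hw8⟩ | ⟨_, hw8⟩ <;> omega
  have hv8 : v ^ 2 % 8 = 1 := sq_mod_eight_of_odd hv2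
  have hS5 : (u ^ 2 + w ^ 2) % 8 = 5 := by
    rcases sq_mod_eight_cases w with ⟨hw1, _⟩ | ⟨_, hw8⟩ | ⟨_, hw8⟩ <;> omega
  obtain ⟨ℓ, hℓ, hℓS, hℓ8⟩ := exists_prime_dvd_mod_eight_eq_five (a := u ^ 2 + w ^ 2) rfl hS5
  have hSpos : 0 < u ^ 2 + w ^ 2 := by omega
  have hℓle : ℓ ≤ u ^ 2 + w ^ 2 := Nat.le_of_dvd hSpos hℓS
  have hv1 : 1 ≤ v ^ 2 := Nat.one_le_pow 2 v (by omega)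
  have hid : (u ^ 2 + w ^ 2) + 2 * v ^ 2 = p := by omega
  have hℓlt : ℓ < p := by omega
  have hℓv : ¬ ℓ ∣ v := by
    intro hℓv'
    have hℓp : ℓ ∣ p := by
      have h1 : ℓ ∣ 2 * v ^ 2 := Dvd.dvd.mul_left (Dvd.dvd.pow hℓv' two_ne_zero) 2
      rw [← hid]
      exact Dvd.dvd.add hℓS h1
    have := (Nat.prime_dvd_prime_iff_eq hℓ hp).mp hℓp
    omega
  refine ⟨ℓ, hℓ, hℓlt, hℓ8, ?_⟩
  have hpℓ : jacobiSym (p : ℤ) ℓ = -1 :=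
    jacobiSym_eq_neg_one_of_add_two_mul_sq hℓ (Or.inr hℓ8) hℓS hid hℓv
  rw [jacobiSym.quadratic_reciprocity_one_mod_four (by omega) (Nat.odd_iff.mpr (by omega)), hpℓ]

/-! ## §4 Target T_A of the card: the Heegner field `K′ = ℚ(√−5ℓ)` for `W = B_p`, `p ≡ 5 (mod 8)`, `p ≡ ±2 (mod 5)` -/

/-- `(−5ℓ/p) = +1` for `p ≡ 5 (mod 8)`, `p ≡ ±2 (mod 5)` and `(ℓ/p) = −1`: `(−1/p) = +1`, `(5/p) = (p/5) = −1`. [folklore] -/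
theorem jacobiSym_neg_five_mul_of_mod_eight_eq_five {p ℓ : ℕ} (hp8 : p % 8 = 5) (hp5 : p % 5 = 2 ∨ p % 5 = 3)
    (hJ : jacobiSym (ℓ : ℤ) p = -1) : jacobiSym (-(5 * (ℓ : ℤ))) p = 1 := by
  have hm1 : jacobiSym (-1) p = 1 := jacobiSym_neg_one_eq_one (by omega)
  have h5 : jacobiSym 5 p = -1 := jacobiSym_five_eq_neg_one (by omega) hp5
  have : (-(5 * (ℓ : ℤ))) = (-1) * 5 * (ℓ : ℤ) := by ring
  rw [this, jacobiSym.mul_left, jacobiSym.mul_left, hm1, h5, hJ]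
  norm_num

/-- **T_A, field half** (card `sqrt2-isogeny-heegner-pin`): for every prime `p ≡ 5 (mod 8)`, `p ≡ ±2 (mod 5)` there are a prime
`ℓ < p`, `ℓ ≡ 3 (mod 8)`, `(ℓ/p) = −1`, and a number field `K′` (`= ℚ(√−5ℓ)`) which is imaginary quadratic with `d_{K′} = −5ℓ`
(`≡ 1 (mod 8)`, `(d_{K′}/p) = +1`), satisfies the Heegner hypothesis for every level `N` whose prime divisors lie in `{2, p}` (so for
`N(B_p) = 2⁸p²` once that conductor is available), and has `h(K′) < p`; moreover the twist parameter `m = 5·p·ℓ` of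
`B_p^{(d_{K′})} = B_{−5pℓ}` is square-free with every prime factor `≡ 3` or `5 (mod 8)` (CELL-5 membership). The `L`-half
(`L(B_{−5pℓ}, 1) ≠ 0` via the [√−2]-isogeny descent) is NOT proved here. [cite: Marcus2018, Ch. 2 Thm. 1; Ch. 3 Thm. 25]
[cite: Oesterle1988Gauss, II §3 Proposition p. 57 (27)] -/
theorem exists_sqrtTwoPin_witnessField {p : ℕ} (hp : p.Prime) (hp8 : p % 8 = 5) (hp5 : p % 5 = 2 ∨ p % 5 = 3) {N : ℕ}
    (hN : ∀ r : ℕ, r.Prime → r ∣ N → r = 2 ∨ r = p) :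
    ∃ (ℓ : ℕ) (K : Type) (_ : Field K) (_ : NumberField K),
      ℓ.Prime ∧ ℓ < p ∧ ℓ % 8 = 3 ∧ jacobiSym (ℓ : ℤ) p = -1 ∧
      (-(5 * (ℓ : ℤ))) % 8 = 1 ∧ jacobiSym (-(5 * (ℓ : ℤ))) p = 1 ∧
      IsImaginaryQuadratic K ∧ NumberField.discr K = -((5 * ℓ : ℕ) : ℤ) ∧
      SatisfiesHeegnerHypothesis N K ∧ NumberField.classNumber K < p ∧
      Squarefree (5 * p * ℓ) ∧ (∀ r : ℕ, r.Prime → r ∣ 5 * p * ℓ → r % 8 = 3 ∨ r % 8 = 5) := by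
  obtain ⟨ℓ, hℓ, hℓlt, hℓ8, hJ⟩ := pinThreeMinus_of_mod_eight_eq_five p hp hp8
  have hJ5 := jacobiSym_neg_five_mul_of_mod_eight_eq_five hp8 hp5 hJ
  have hp13 : 13 ≤ p := by
    rcases hp5 with h | h <;> omega
  obtain ⟨K, iF, iN, hK, hdK, hH, hcl⟩ :=
    exists_witnessField_five (N := N) hp (by omega) hℓ hℓ8 hJ5 (by omega) hN
  refine ⟨ℓ, K, iF, iN, hℓ, hℓlt, hℓ8, hJ, neg_five_mul_emod_eight hℓ8, hJ5, hK, hdK, hH, hcl, ?_, ?_⟩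
  · -- `5, p, ℓ` are distinct primes
    have hp5' : p ≠ 5 := by rintro rfl; omega
    have hℓ5 : ℓ ≠ 5 := by rintro rfl; omega
    have hℓp : ℓ ≠ p := by omega
    have h1 : Squarefree (5 * p) := by
      rw [Nat.squarefree_mul ((Nat.coprime_primes Nat.prime_five hp).mpr (Ne.symm hp5'))]
      exact ⟨Nat.prime_five.squarefree, hp.squarefree⟩
    have hcop : Nat.Coprime (5 * p) ℓ :=
      Nat.Coprime.mul_left ((Nat.coprime_primes Nat.prime_five hℓ).mpr (Ne.symm hℓ5))
        ((Nat.coprime_primes hp hℓ).mpr (Ne.symm hℓp))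
    rw [Nat.squarefree_mul hcop]
    exact ⟨h1, hℓ.squarefree⟩
  · intro r hr hrd
    rcases (Nat.Prime.dvd_mul hr).mp hrd with h | h
    · rcases (Nat.Prime.dvd_mul hr).mp h with h' | h'
      · have := (Nat.prime_dvd_prime_iff_eq hr Nat.prime_five).mp h'
        omega
      · have := (Nat.prime_dvd_prime_iff_eq hr hp).mp h'
        omega
    · have := (Nat.prime_dvd_prime_iff_eq hr hℓ).mp h
      omega

end Summit.BirchSwinnertonDyer.BirchSwinnertonDyer.Theorems.BiquadraticEisensteinDescentHeegnerTwistCouplingInSupplySqrtTwoPin
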